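import Literature.RingTheory.Etale.PiTensorProductField
import Mathlib.LinearAlgebra.Basis.VectorSpace
import Mathlib.FieldTheory.IntermediateField.Adjoin.Basic
import Mathlib.Algebra.Algebra.Pi
import HarnessLib

/-!
# Finite tensor products of ind-étale algebras over a field are ind-étale

Classical commutative algebra complementing `Literature/RingTheory/Etale/PiTensorProductField.lean`
(Knus–Merkurjev–Rost–Tignol, *The Book of Involutions*, §18.A Prop. (18.3) / Thm. (18.4): finite
étale algebras over a field `K` are the finite products of finite separable field extensions, and
they are stable under finite tensor products), at the level of NOT necessarily finite algebras:
call a commutative `K`-algebra *ind-(finite étale)* when every finite subset lies in a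
`K`-subalgebra which is finite-dimensional and formally unramified (= finite étale). This file
proves (theorems only, no new definitions — the property is spelled out inline):

* `piTensorProduct_map_algHom_one` / `piTensorProduct_map_algHom_mul` : for a family of algebra
  homomorphisms `g i : B i →ₐ[R] M i`, the linear map `PiTensorProduct.map (g ·)` of the finite
  tensor products is multiplicative and unital (so `AlgHom.ofLinearMap` applies);
* `piTensorProduct_map_injective_of_leftInverse` / `piTensorProduct_map_injective` : over a field,
  `PiTensorProduct.map` of injective linear maps is injective (every injection of vector spaces has
  a linear retraction, and `PiTensorProduct.map` is functorial);
* `exists_finsets_mem_range_piTensorProduct_map` : every element of `⨂[R] i, M i` lies in the image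
  of `⨂[R] i, B i` for some family of subalgebras `B i` each containing a prescribed FINITE set;
* `piTensorProduct_exists_finiteEtale_subalgebra` : **for finitely many ind-(finite étale)
  algebras `M i` over a field `K`, `⨂[K] i, M i` is ind-(finite étale)**; with
  `exists_algEquiv_pi_field_of_formallyUnramified` this gives
  `piTensorProduct_exists_subalgebra_algEquiv_pi_field` : every finite subset of `⨂[K] i, M i`
  lies in a `K`-subalgebra `K`-isomorphic to a finite product of finite separable field extensions;
* the two instances the consumers need: an algebraic separable field extension is ind-(finite
  étale) (`exists_finiteEtale_subalgebra_of_isSeparable`: adjoin the finite set), and a finite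
  product of ind-(finite étale) algebras is ind-(finite étale) (`exists_finiteEtale_subalgebra_pi`).

Consumer: the MODEL level of [IUTchIII] Prop. 3.1 (i) (`Literature/IUT/LogThetaLattice/`,
`Prop31i_locallyProductOfFields`: the tensor packet of the ind-fields `log(^α𝓕_v) ≅ k̄` is "an
inductive limit of direct sums of fields"). Nothing here is specific to that consumer.
-/

namespace Literature.RingTheory.Etale

open scoped TensorProduct
open PiTensorProduct

universe u v v' w w'

/-! ### `PiTensorProduct.map` of algebra homomorphisms is an algebra homomorphism -/

section MapAlgHom

variable {R : Type u} [CommRing R] {ι : Type v}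
variable {B : ι → Type w} {M : ι → Type w'}
variable [∀ i, CommRing (B i)] [∀ i, Algebra R (B i)] [∀ i, CommRing (M i)] [∀ i, Algebra R (M i)]

/-- `PiTensorProduct.map` of a family of algebra homomorphisms sends `1 = ⊗ᵢ 1` to `1`.
[cite: KnusEtAl1998, §18.A Thm. 18.4] -/
theorem piTensorProduct_map_algHom_one (g : ∀ i, B i →ₐ[R] M i) :
    PiTensorProduct.map (fun i => (g i).toLinearMap) (1 : ⨂[R] i, B i) = 1 := by
  rw [PiTensorProduct.one_def, PiTensorProduct.map_tprod, PiTensorProduct.one_def]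
  congr 1
  funext i
  simp

/-- `PiTensorProduct.map` of a family of algebra homomorphisms is multiplicative (checked on
scaled pure tensors, `(r • ⊗ xᵢ) * (s • ⊗ yᵢ) = (rs) • ⊗ (xᵢyᵢ)`, and extended additively).
[cite: KnusEtAl1998, §18.A Thm. 18.4] -/
theorem piTensorProduct_map_algHom_mul (g : ∀ i, B i →ₐ[R] M i) (x y : ⨂[R] i, B i) :
    PiTensorProduct.map (fun i => (g i).toLinearMap) (x * y) =
      PiTensorProduct.map (fun i => (g i).toLinearMap) x *
        PiTensorProduct.map (fun i => (g i).toLinearMap) y := by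
  induction x using PiTensorProduct.induction_on with
  | smul_tprod r f =>
    induction y using PiTensorProduct.induction_on with
    | smul_tprod s f' =>
      simp only [PiTensorProduct.smul_tprod_mul_smul_tprod, map_smul, PiTensorProduct.map_tprod]
      congr 1
      congr 1
      funext i
      simp [Pi.mul_apply]
    | add y y' hy hy' => simp only [mul_add, map_add, hy, hy']
  | add x x' hx hx' => simp only [add_mul, map_add, hx, hx']

/-- The range of `PiTensorProduct.map` of a family of algebra homomorphisms, viewed through
`AlgHom.ofLinearMap`, has the same membership as the range of the linear map.
[cite: KnusEtAl1998, §18.A Thm. 18.4] -/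
theorem mem_range_ofLinearMap_piTensorProduct_map (g : ∀ i, B i →ₐ[R] M i) (z : ⨂[R] i, M i) :
    z ∈ (AlgHom.ofLinearMap (PiTensorProduct.map fun i => (g i).toLinearMap)
        (piTensorProduct_map_algHom_one g) (piTensorProduct_map_algHom_mul g)).range ↔
      z ∈ LinearMap.range (PiTensorProduct.map fun i => (g i).toLinearMap) := by
  simp only [AlgHom.mem_range, LinearMap.mem_range, AlgHom.ofLinearMap_apply]

end MapAlgHom

/-! ### Injectivity of `PiTensorProduct.map` -/

section Injective

variable {R : Type u} [CommRing R] {ι : Type v}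
variable {V : ι → Type w} {W : ι → Type w'}
variable [∀ i, AddCommGroup (V i)] [∀ i, Module R (V i)] [∀ i, AddCommGroup (W i)] [∀ i, Module R (W i)]

/-- `PiTensorProduct.map f` is injective as soon as every `f i` has a linear left inverse
(functoriality: `map g ∘ map f = map (g ∘ f) = map id = id`). [cite: KnusEtAl1998, §18.A Thm. 18.4] -/
theorem piTensorProduct_map_injective_of_leftInverse (f : ∀ i, V i →ₗ[R] W i)
    (g : ∀ i, W i →ₗ[R] V i) (hgf : ∀ i, g i ∘ₗ f i = LinearMap.id) :
    Function.Injective (PiTensorProduct.map f) := by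
  have hcomp : PiTensorProduct.map g ∘ₗ PiTensorProduct.map f = LinearMap.id := by
    rw [← PiTensorProduct.map_comp]
    have : (fun i => g i ∘ₗ f i) = fun i => (LinearMap.id : V i →ₗ[R] V i) := funext hgf
    rw [this, PiTensorProduct.map_id]
  intro x y hxy
  have := congrArg (PiTensorProduct.map g) hxy
  rwa [← LinearMap.comp_apply, ← LinearMap.comp_apply, hcomp, LinearMap.id_apply,
    LinearMap.id_apply] at this

end Injective

section InjectiveField

variable {K : Type u} [Field K] {ι : Type v}
variable {V : ι → Type w} {W : ι → Type w'}
variable [∀ i, AddCommGroup (V i)] [∀ i, Module K (V i)] [∀ i, AddCommGroup (W i)] [∀ i, Module K (W i)]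

/-- **Over a field, `PiTensorProduct.map` of injective linear maps is injective** (every
injection of vector spaces admits a linear retraction, `LinearMap.exists_leftInverse_of_injective`).
[cite: KnusEtAl1998, §18.A Thm. 18.4] -/
theorem piTensorProduct_map_injective (f : ∀ i, V i →ₗ[K] W i)
    (hf : ∀ i, Function.Injective (f i)) : Function.Injective (PiTensorProduct.map f) := by
  choose g hg using fun i =>
    (f i).exists_leftInverse_of_injective (LinearMap.ker_eq_bot.mpr (hf i))
  exact piTensorProduct_map_injective_of_leftInverse f g hg

end InjectiveField

/-! ### Finite generation: every element comes from finitely generated sub-factors -/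

section Generation

variable {R : Type u} [CommRing R] {ι : Type v}
variable {M : ι → Type w} [∀ i, CommRing (M i)] [∀ i, Algebra R (M i)]

/-- Every element `x` of `⨂[R] i, M i` is determined by finitely many coordinates: there are finite
sets `S i ⊆ M i` such that `x` lies in the image of `⨂[R] i, B i → ⨂[R] i, M i` for EVERY family of
subalgebras `B i ⊇ S i` (pure tensors `r • ⊗ᵢ xᵢ`: take `S i = {xᵢ}`; sums: take unions).
[cite: KnusEtAl1998, §18.A Thm. 18.4] -/
theorem exists_finsets_mem_range_piTensorProduct_map (x : ⨂[R] i, M i) :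
    ∃ S : ∀ i, Finset (M i), ∀ B : ∀ i, Subalgebra R (M i),
      (∀ i, (↑(S i) : Set (M i)) ⊆ B i) →
        x ∈ LinearMap.range (PiTensorProduct.map fun i => (B i).val.toLinearMap) := by
  classical
  induction x using PiTensorProduct.induction_on with
  | smul_tprod r f =>
    refine ⟨fun i => {f i}, fun B hB => ?_⟩
    have hf : ∀ i, f i ∈ B i := fun i => hB i (by simp)
    refine ⟨r • tprod R fun i => (⟨f i, hf i⟩ : B i), ?_⟩
    simp only [map_smul, PiTensorProduct.map_tprod]
    rfl
  | add x y hx hy =>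
    obtain ⟨S, hS⟩ := hx
    obtain ⟨T, hT⟩ := hy
    refine ⟨fun i => S i ∪ T i, fun B hB => ?_⟩
    refine Submodule.add_mem _ (hS B fun i => ?_) (hT B fun i => ?_)
    · exact fun z hz => hB i (by simp only [Finset.coe_union]; exact Or.inl hz)
    · exact fun z hz => hB i (by simp only [Finset.coe_union]; exact Or.inr hz)

end Generation

/-! ### The main theorem: `⨂` of ind-(finite étale) algebras over a field is ind-(finite étale) -/

section Main

variable (K : Type u) [Field K] {ι : Type v} [Finite ι]
variable (M : ι → Type w) [∀ i, CommRing (M i)] [∀ i, Algebra K (M i)]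

/-- **Finite tensor products preserve ind-(finite étale) algebras over a field.** If every finite
subset of each `M i` (finitely many commutative `K`-algebras) lies in a finite-dimensional formally
unramified `K`-subalgebra, then so does every finite subset of `⨂[K] i, M i`: it lies in the image
`C` of `⨂[K] i, B i` for suitable finite étale subalgebras `B i ⊆ M i`; that image is a
`K`-subalgebra, the map onto it is injective (flatness over a field), and `⨂[K] i, B i` is finite
(`PiTensorProduct.finite`) and formally unramified (`formallyUnramified_piTensorProduct`,
Thm. (18.4) of the cited source). [cite: KnusEtAl1998, §18.A Thm. 18.4] -/
theorem piTensorProduct_exists_finiteEtale_subalgebra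
    (hM : ∀ i (s : Finset (M i)), ∃ B : Subalgebra K (M i),
      (↑s : Set (M i)) ⊆ B ∧ Module.Finite K B ∧ Algebra.FormallyUnramified K B)
    (s : Finset (⨂[K] i, M i)) :
    ∃ C : Subalgebra K (⨂[K] i, M i),
      (↑s : Set (⨂[K] i, M i)) ⊆ C ∧ Module.Finite K C ∧ Algebra.FormallyUnramified K C := by
  classical
  choose S hS using fun x : ⨂[K] i, M i => exists_finsets_mem_range_piTensorProduct_map x
  choose B hB using fun i => hM i (s.biUnion fun x => S x i)
  have hfin : ∀ i, Module.Finite K (B i) := fun i => (hB i).2.1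
  have hunr : ∀ i, Algebra.FormallyUnramified K (B i) := fun i => (hB i).2.2
  let Φ : (⨂[K] i, B i) →ₐ[K] ⨂[K] i, M i :=
    AlgHom.ofLinearMap (PiTensorProduct.map fun i => (B i).val.toLinearMap)
      (piTensorProduct_map_algHom_one fun i => (B i).val)
      (piTensorProduct_map_algHom_mul fun i => (B i).val)
  have hΦ : Function.Injective Φ := by
    change Function.Injective (PiTensorProduct.map fun i => (B i).val.toLinearMap)
    exact piTensorProduct_map_injective _ fun i => Subtype.val_injective
  let e : (⨂[K] i, B i) ≃ₐ[K] Φ.range := AlgEquiv.ofInjective Φ hΦ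
  have hunrB : Algebra.FormallyUnramified K (⨂[K] i, B i) :=
    formallyUnramified_piTensorProduct (R := K) fun i => B i
  refine ⟨Φ.range, fun x hx => ?_, Module.Finite.equiv e.toLinearEquiv,
    Algebra.FormallyUnramified.of_equiv e⟩
  rw [SetLike.mem_coe, mem_range_ofLinearMap_piTensorProduct_map]
  refine hS x B fun i z hz => (hB i).1 ?_
  simp only [Finset.coe_biUnion, Finset.mem_coe, Set.mem_iUnion, exists_prop]
  exact ⟨x, hx, hz⟩

/-- **Every finite subset of a finite tensor product of ind-(finite étale) algebras over a field
lies in a subalgebra isomorphic to a finite product of finite separable field extensions**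
(`piTensorProduct_exists_finiteEtale_subalgebra` with Prop. (18.3): finite étale = finite product
of finite separable extensions, `exists_algEquiv_pi_field_of_formallyUnramified`).
[cite: KnusEtAl1998, §18.A Prop. 18.3] -/
theorem piTensorProduct_exists_subalgebra_algEquiv_pi_field
    (hM : ∀ i (s : Finset (M i)), ∃ B : Subalgebra K (M i),
      (↑s : Set (M i)) ⊆ B ∧ Module.Finite K B ∧ Algebra.FormallyUnramified K B)
    (s : Finset (⨂[K] i, M i)) :
    ∃ C : Subalgebra K (⨂[K] i, M i), (↑s : Set (⨂[K] i, M i)) ⊆ C ∧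
      ∃ (κ : Type (max u v w)) (_ : Fintype κ) (F : κ → Type (max u v w)) (_ : ∀ k, Field (F k))
        (_ : ∀ k, Algebra K (F k)),
        (∀ k, Module.Finite K (F k) ∧ Algebra.IsSeparable K (F k)) ∧ Nonempty (C ≃ₐ[K] ∀ k, F k) := by
  obtain ⟨C, hsC, hfin, hunr⟩ := piTensorProduct_exists_finiteEtale_subalgebra K M hM s
  exact ⟨C, hsC, exists_algEquiv_pi_field_of_formallyUnramified K C⟩

end Main

/-! ### Instances of the ind-(finite étale) property -/

section Instances

variable (K : Type u) [Field K]

/-- **An algebraic separable field extension is ind-(finite étale)**: a finite subset `s ⊆ E`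
lies in `K(s)`, which is finite-dimensional (the elements are algebraic) and separable over `K`,
hence formally unramified. [cite: KnusEtAl1998, §18.A Prop. 18.3] -/
theorem exists_finiteEtale_subalgebra_of_isSeparable (E : Type w) [Field E] [Algebra K E]
    [Algebra.IsSeparable K E] (s : Finset E) :
    ∃ B : Subalgebra K E, (↑s : Set E) ⊆ B ∧ Module.Finite K B ∧ Algebra.FormallyUnramified K B := by
  have hfd : FiniteDimensional K (IntermediateField.adjoin K (s : Set E)) :=
    IntermediateField.finiteDimensional_adjoin fun x _ => Algebra.IsIntegral.isIntegral x
  have hsep : Algebra.IsSeparable K (IntermediateField.adjoin K (s : Set E)) := inferInstance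
  have hunr : Algebra.FormallyUnramified K (IntermediateField.adjoin K (s : Set E)) :=
    Algebra.FormallyUnramified.of_isSeparable K _
  exact ⟨(IntermediateField.adjoin K (s : Set E)).toSubalgebra,
    fun x hx => IntermediateField.subset_adjoin K _ hx, hfd, hunr⟩

/-- **A finite product of ind-(finite étale) algebras is ind-(finite étale)**: a finite subset
`s ⊆ Π j, N j` lies in `Π j, B j` for finite étale subalgebras `B j ⊇ prⱼ(s)`, and a finite
product of finite formally unramified algebras is finite and formally unramified.
[cite: KnusEtAl1998, §18.A Prop. 18.3] -/
theorem exists_finiteEtale_subalgebra_pi {J : Type v} [Finite J] (N : J → Type w)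
    [∀ j, CommRing (N j)] [∀ j, Algebra K (N j)]
    (hN : ∀ j (s : Finset (N j)), ∃ B : Subalgebra K (N j),
      (↑s : Set (N j)) ⊆ B ∧ Module.Finite K B ∧ Algebra.FormallyUnramified K B)
    (s : Finset (∀ j, N j)) :
    ∃ B : Subalgebra K (∀ j, N j),
      (↑s : Set (∀ j, N j)) ⊆ B ∧ Module.Finite K B ∧ Algebra.FormallyUnramified K B := by
  classical
  choose B hB using fun j => hN j (s.image fun x => x j)
  have hfin : ∀ j, Module.Finite K (B j) := fun j => (hB j).2.1
  have hunr : ∀ j, Algebra.FormallyUnramified K (B j) := fun j => (hB j).2.2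
  let Φ : (∀ j, B j) →ₐ[K] ∀ j, N j :=
    AlgHom.pi fun j => (B j).val.comp (Pi.evalAlgHom K (fun j => B j) j)
  have hΦapply : ∀ (x : ∀ j, B j) (j : J), Φ x j = (x j : N j) := fun x j => rfl
  have hΦ : Function.Injective Φ := by
    intro x y hxy
    funext j
    exact Subtype.ext (by rw [← hΦapply x j, ← hΦapply y j, hxy])
  let e : (∀ j, B j) ≃ₐ[K] Φ.range := AlgEquiv.ofInjective Φ hΦ
  refine ⟨Φ.range, fun x hx => ?_, Module.Finite.equiv e.toLinearEquiv,
    Algebra.FormallyUnramified.of_equiv e⟩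
  have hxB : ∀ j, x j ∈ B j := fun j =>
    (hB j).1 (by simp only [Finset.coe_image, Set.mem_image, Finset.mem_coe]; exact ⟨x, hx, rfl⟩)
  exact ⟨fun j => ⟨x j, hxB j⟩, funext fun j => rfl⟩

/-- The two instances combined, in the shape the tensor-packet consumer uses: for finitely many
labels `j` and algebraic separable field extensions `L j` of `K`, every finite subset of `Π j, L j`
lies in a finite étale `K`-subalgebra. [cite: KnusEtAl1998, §18.A Prop. 18.3] -/
theorem exists_finiteEtale_subalgebra_pi_field {J : Type v} [Finite J] (L : J → Type w)
    [∀ j, Field (L j)] [∀ j, Algebra K (L j)] [∀ j, Algebra.IsSeparable K (L j)]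
    (s : Finset (∀ j, L j)) :
    ∃ B : Subalgebra K (∀ j, L j),
      (↑s : Set (∀ j, L j)) ⊆ B ∧ Module.Finite K B ∧ Algebra.FormallyUnramified K B :=
  exists_finiteEtale_subalgebra_pi K L (fun j t => exists_finiteEtale_subalgebra_of_isSeparable K (L j) t) s

end Instances

/-! ### Packaged consumer form: tensor products of products of algebraic separable fields -/

section Packaged

variable (K : Type u) [Field K] {ι : Type v} [Finite ι] {J : Type v'} [Finite J]

/-- **`⊗ᵢ Πⱼ Lᵢⱼ` is locally a finite product of fields.** For finitely many labels `i`, `j` and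
field extensions `L i j` of `K` that are algebraic and separable (NOT necessarily finite — e.g.
algebraic closures in characteristic `0`), every finite subset of `⨂[K] i, (Π j, L i j)` lies in
a `K`-subalgebra `K`-isomorphic to a finite product of finite separable field extensions of `K`:
the tensor product is the directed union ("inductive limit") of such subalgebras.
[cite: KnusEtAl1998, §18.A Thm. 18.4] -/
theorem piTensorProduct_pi_fields_exists_subalgebra_algEquiv_pi_field (L : ι → J → Type w)
    [∀ i j, Field (L i j)] [∀ i j, Algebra K (L i j)] [∀ i j, Algebra.IsSeparable K (L i j)]
    (s : Finset (⨂[K] i, (∀ j, L i j))) :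
    ∃ C : Subalgebra K (⨂[K] i, (∀ j, L i j)), (↑s : Set (⨂[K] i, (∀ j, L i j))) ⊆ C ∧
      ∃ (κ : Type (max u v v' w)) (_ : Fintype κ) (F : κ → Type (max u v v' w)) (_ : ∀ k, Field (F k))
        (_ : ∀ k, Algebra K (F k)),
        (∀ k, Module.Finite K (F k) ∧ Algebra.IsSeparable K (F k)) ∧ Nonempty (C ≃ₐ[K] ∀ k, F k) :=
  piTensorProduct_exists_subalgebra_algEquiv_pi_field K (fun i => ∀ j, L i j)
    (fun i t => exists_finiteEtale_subalgebra_pi_field K (L i) t) s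

/-- Characteristic-zero form (separability automatic): for algebraic field extensions `L i j` of a
field `K` of characteristic `0`, every finite subset of `⨂[K] i, (Π j, L i j)` lies in a
`K`-subalgebra isomorphic to a finite product of finite field extensions of `K`.
[cite: KnusEtAl1998, §18.A Thm. 18.4] -/
theorem piTensorProduct_pi_fields_exists_subalgebra_algEquiv_pi_field_of_charZero [CharZero K]
    (L : ι → J → Type w) [∀ i j, Field (L i j)] [∀ i j, Algebra K (L i j)]
    [∀ i j, Algebra.IsAlgebraic K (L i j)] (s : Finset (⨂[K] i, (∀ j, L i j))) :
    ∃ C : Subalgebra K (⨂[K] i, (∀ j, L i j)), (↑s : Set (⨂[K] i, (∀ j, L i j))) ⊆ C ∧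
      ∃ (κ : Type (max u v v' w)) (_ : Fintype κ) (F : κ → Type (max u v v' w)) (_ : ∀ k, Field (F k))
        (_ : ∀ k, Algebra K (F k)),
        (∀ k, Module.Finite K (F k) ∧ Algebra.IsSeparable K (F k)) ∧ Nonempty (C ≃ₐ[K] ∀ k, F k) := by
  have : ∀ i j, Algebra.IsSeparable K (L i j) := fun i j => inferInstance
  exact piTensorProduct_pi_fields_exists_subalgebra_algEquiv_pi_field K L s

end Packaged

end Literature.RingTheory.Etale
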